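import Summits.BirchSwinnertonDyer.BirchSwinnertonDyer.Theses.PadicCornerSqueeze
import Summits.BirchSwinnertonDyer.BirchSwinnertonDyer.Theorems.SelmerRankUB.Negative.CounterexampleProfile
import Summits.BirchSwinnertonDyer.BirchSwinnertonDyer.Theorems.FrozenTwinSerrePrimeSupply

/-!
# Crux-attack r1 probes — `PadicCornerSqueeze.SelmerCapAtOnePrime` (stmt-BirchSwinnertonDyer-19215)

Refuter seat `refuter-rattack-stmt-BirchSwinnertonDyer-19215-0`, 2026-08-17 (crux attack at birth).
Kernel-checked companions of `CruxAttack-r1.md` (all sorry-free, axioms ⊆ {propext, Classical.choice,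
Quot.sound}). The crux is

  `C3 := ∀ W [IsElliptic] [IsGloballyMinimal], 2 ≤ r_an(W) → ∃ p prime, corank_{ℤ_p} Sel_{p^∞}(W/ℚ) ≤ r_an(W)`.

Findings typed here:
* §1 `selmerCap_iff_rank_add_shaCorank` — through the LANDED Kummer identity
  `selmerCorank = mordellWeilRank + shaCorank` (`selmerCorank_eq_mordellWeilRank_add_holds`):
  `C3 ⇔ ∀ W, 2 ≤ r_an → ∃ p, rank + corank Ш[p^∞] ≤ r_an`; `not_selmerCap_iff` — the counterexample shape
  (ONE curve, failure at EVERY prime); `excessRank_or_allDivisibleSha_of_failure`.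
* §2 restates-summit: `C → S` NO — C3 gives exactly the LOW half `rank ≤ r_an` in analytic rank ≥ 2
  (`rankLe_of_selmerCap`, `selmerCap_iff_low_and_sha`, `bsd_high_of_selmerCap_of_up`); `S → C` NO — modulo
  the summit C3 is one-prime Ш[p^∞]-cofiniteness (`selmerCap_iff_shaCorankZero_of_bsd`).
* §3 no hypothesis load-bearing for truth: summit + Ш[p^∞] finite at one prime per curve ⇒ the conclusion
  for EVERY elliptic W (`selmerCap_conclusion_of_summit_of_shaFiniteAtOnePrime`); summit + stmt-0132 ⇒ C3
  (`selmerCap_of_summit_of_shaPFinite`); contrapositive `not_summit_or_allInfiniteSha_of_not_selmerCap` —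
  C3 cannot be refuted-misstated.
* §4 relation to the sibling ∀-form crux `SelmerRankUB` (stmt-0130): 0130 ⇒ C3 on non-CM curves via the
  proved Serre supply (`selmerCap_nonCM_of_selmerRankUB`, `selmerCap_of_selmerRankUB_of_cm`).
* §5 mutation / cells: `2 ≤ r_an` dropped holds modulo GZK (`selmerCap_conclusion_of_analyticRank_le_one`);
  parity gap — a counterexample curve has `corank_p ≥ 4` at every prime, modulo DD2010 `p`-parity
  (`four_le_selmerCorank_everywhere_of_failure`).
-/

set_option linter.dupNamespace false

namespace Summit.BirchSwinnertonDyer.BirchSwinnertonDyer.Cruxes.SelmerCapAtOnePrime.Attack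

open Summit.BirchSwinnertonDyer.BirchSwinnertonDyer.Theses
open Summit.BirchSwinnertonDyer.BirchSwinnertonDyer.Theses.PadicCornerSqueeze (SelmerCapAtOnePrime)
open Summit.BirchSwinnertonDyer.BirchSwinnertonDyer.Theorems
open Literature.NumberTheory.EllipticCurves

/-! ## §1 Shape through the Kummer identity -/

/-- Unconditional reformulation: C3 ⇔ ∀ W, 2 ≤ r_an → ∃ p, rank + corank Ш[p^∞] ≤ r_an
(Greenberg LNM 1716 §1 identity, tree theorem `selmerCorank_eq_mordellWeilRank_add_holds`). -/
theorem selmerCap_iff_rank_add_shaCorank : SelmerCapAtOnePrime ↔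
    ∀ (W : WeierstrassCurve ℚ) [W.IsElliptic] [W.IsGloballyMinimal], 2 ≤ W.analyticRank →
      ∃ (p : ℕ) (_ : Fact p.Prime), W.mordellWeilRank + W.shaCorank p ≤ W.analyticRank := by
  unfold SelmerCapAtOnePrime
  constructor
  · intro h W _ _ hr
    obtain ⟨p, hp, hle⟩ := h W hr
    refine ⟨p, hp, ?_⟩
    have hid := @WeierstrassCurve.selmerCorank_eq_mordellWeilRank_add_holds ℚ _ _ W _ p hp
    omega
  · intro h W _ _ hr
    obtain ⟨p, hp, hle⟩ := h W hr
    refine ⟨p, hp, ?_⟩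
    have hid := @WeierstrassCurve.selmerCorank_eq_mordellWeilRank_add_holds ℚ _ _ W _ p hp
    omega

/-- What a disproof must produce: ONE globally minimal elliptic `W` with `r_an ≥ 2` such that at EVERY
prime `r_an < rank + corank Ш[p^∞]`. -/
theorem not_selmerCap_iff : ¬ SelmerCapAtOnePrime ↔
    ∃ (W : WeierstrassCurve ℚ) (_ : W.IsElliptic) (_ : W.IsGloballyMinimal), 2 ≤ W.analyticRank ∧
      ∀ (p : ℕ) [Fact p.Prime], W.analyticRank < W.mordellWeilRank + W.shaCorank p := by
  unfold SelmerCapAtOnePrime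
  constructor
  · intro h
    by_contra hne
    apply h
    intro W _ _ hr
    by_contra hall
    apply hne
    refine ⟨W, inferInstance, inferInstance, hr, fun p _ => ?_⟩
    have h2 : W.selmerCorank p = W.mordellWeilRank + W.shaCorank p :=
      W.selmerCorank_eq_mordellWeilRank_add_holds p
    by_contra hlt
    exact hall ⟨p, inferInstance, by omega⟩
  · rintro ⟨W, _, _, hr, hall⟩ h
    obtain ⟨p, hp, hle⟩ := h W hr
    have h1 := @hall p hp
    have h2 : W.selmerCorank p = W.mordellWeilRank + W.shaCorank p :=
      @WeierstrassCurve.selmerCorank_eq_mordellWeilRank_add_holds ℚ _ _ W _ p hp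
    omega

/-- Pointwise dichotomy for a counterexample curve: EXCESS RANK (`rank > r_an`, ¬ BSD-rank at `W`) or
`Ш[p^∞]` of positive corank (infinite) at EVERY prime. -/
theorem excessRank_or_allDivisibleSha_of_failure (W : WeierstrassCurve ℚ) [W.IsElliptic]
    (hall : ∀ (p : ℕ) [Fact p.Prime], W.analyticRank < W.mordellWeilRank + W.shaCorank p) :
    W.analyticRank < W.mordellWeilRank ∨ ∀ (p : ℕ) [Fact p.Prime], 0 < W.shaCorank p := by
  by_cases hx : W.analyticRank < W.mordellWeilRank
  · exact Or.inl hx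
  · right
    intro p _
    have := hall p
    omega

/-! ## §2 Restates-summit probes -/

/-- `C → S` fails; what C3 does give is the LOW half of BSD-rank in analytic rank ≥ 2. -/
theorem rankLe_of_selmerCap (h : SelmerCapAtOnePrime) (W : WeierstrassCurve ℚ) [W.IsElliptic]
    [W.IsGloballyMinimal] (hr : 2 ≤ W.analyticRank) : W.mordellWeilRank ≤ W.analyticRank := by
  obtain ⟨p, hp, hle⟩ := selmerCap_iff_rank_add_shaCorank.mp h W hr
  omega

/-- C3 = (LOW half in r_an ≥ 2) ∧ (one-prime Ш-cap by the defect `r_an − rank`). -/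
theorem selmerCap_iff_low_and_sha : SelmerCapAtOnePrime ↔
    ∀ (W : WeierstrassCurve ℚ) [W.IsElliptic] [W.IsGloballyMinimal], 2 ≤ W.analyticRank →
      W.mordellWeilRank ≤ W.analyticRank ∧
        ∃ (p : ℕ) (_ : Fact p.Prime), W.shaCorank p ≤ W.analyticRank - W.mordellWeilRank := by
  rw [selmerCap_iff_rank_add_shaCorank]
  constructor
  · intro h W _ _ hr
    obtain ⟨p, hp, hle⟩ := h W hr
    exact ⟨by omega, p, hp, by omega⟩
  · intro h W _ _ hr
    obtain ⟨h1, p, hp, hle⟩ := h W hr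
    exact ⟨p, hp, by omega⟩

/-- `S → C` fails: modulo the summit, C3 is EQUIVALENT to one-prime `Ш[p^∞]`-cofiniteness in analytic
rank ≥ 2 — content the summit does not carry (open for every r_an ≥ 2 as a theorem; instance-wise
certified, e.g. Stein–Wuthrich 2013). -/
theorem selmerCap_iff_shaCorankZero_of_bsd (hS : _root_.BirchSwinnertonDyer) :
    SelmerCapAtOnePrime ↔
      ∀ (W : WeierstrassCurve ℚ) [W.IsElliptic] [W.IsGloballyMinimal], 2 ≤ W.analyticRank →
        ∃ (p : ℕ) (_ : Fact p.Prime), W.shaCorank p = 0 := by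
  rw [selmerCap_iff_rank_add_shaCorank]
  constructor
  · intro h W _ _ hr
    obtain ⟨p, hp, hle⟩ := h W hr
    have hS' := hS W ‹_›
    exact ⟨p, hp, by omega⟩
  · intro h W _ _ hr
    obtain ⟨p, hp, h0⟩ := h W hr
    have hS' := hS W ‹_›
    exact ⟨p, hp, by omega⟩

/-- Squeeze bookkeeping isolated: C3 + the UP half on globally minimal models of analytic rank ≥ 2 gives
BSD-rank there (the deciding theorem uses C3 only through `rankLe_of_selmerCap`). -/
theorem bsd_high_of_selmerCap_of_up (h : SelmerCapAtOnePrime)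
    (hup : ∀ (W : WeierstrassCurve ℚ) [W.IsElliptic] [W.IsGloballyMinimal], 2 ≤ W.analyticRank →
      W.analyticRank ≤ W.mordellWeilRank)
    (W : WeierstrassCurve ℚ) [W.IsElliptic] [W.IsGloballyMinimal] (hr : 2 ≤ W.analyticRank) :
    W.analyticRank = W.mordellWeilRank := by
  have h1 := rankLe_of_selmerCap h W hr
  have h2 := hup W hr
  omega

/-! ## §3 Load-bearing analysis: no hypothesis is load-bearing for truth -/

/-- The summit and Ш[p^∞]-finiteness AT ONE PRIME give the conclusion of C3 for EVERY elliptic `W` — no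
minimality, no `2 ≤ r_an`, the prime unrestricted. -/
theorem selmerCap_conclusion_of_summit_of_shaFiniteAtOnePrime (hS : _root_.BirchSwinnertonDyer)
    (W : WeierstrassCurve ℚ) [W.IsElliptic]
    (hSha : ∃ (p : ℕ) (_ : Fact p.Prime), Finite (AddCommGroup.primaryComponent W.sha p)) :
    ∃ (p : ℕ) (_ : Fact p.Prime), W.selmerCorank p ≤ W.analyticRank := by
  obtain ⟨p, hp, hfin⟩ := hSha
  refine ⟨p, hp, ?_⟩
  have h0 : W.analyticRank = W.mordellWeilRank := hS W inferInstance
  have h2 : W.selmerCorank p = W.mordellWeilRank + W.shaCorank p :=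
    W.selmerCorank_eq_mordellWeilRank_add_holds p
  have h3 : W.shaCorank p = 0 := Literature.BSD.shaCorank_eq_zero_of_finite W p hfin
  omega

/-- Summit + `SelmerRank.SelmerRankShaPFinite` (stmt-0132) ⇒ C3 (with `p = 2`). -/
theorem selmerCap_of_summit_of_shaPFinite (hS : _root_.BirchSwinnertonDyer)
    (hSha : SelmerRank.SelmerRankShaPFinite) : SelmerCapAtOnePrime := by
  intro W _ _ _
  exact selmerCap_conclusion_of_summit_of_shaFiniteAtOnePrime hS W ⟨2, ⟨Nat.prime_two⟩, hSha W 2⟩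

/-- Contrapositive: a counterexample to C3 refutes BSD-rank or exhibits a curve with `Ш[p^∞]` INFINITE
AT EVERY PRIME — the crux cannot be "refuted-misstated". -/
theorem not_summit_or_allInfiniteSha_of_not_selmerCap (h : ¬ SelmerCapAtOnePrime) :
    ¬ _root_.BirchSwinnertonDyer ∨
      ∃ (W : WeierstrassCurve ℚ) (_ : W.IsElliptic), ∀ (p : ℕ) [Fact p.Prime],
        ¬ Finite (AddCommGroup.primaryComponent W.sha p) := by
  by_contra hc
  push Not at hc
  obtain ⟨hS, hfin⟩ := hc
  apply h
  intro W _ _ _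
  obtain ⟨p, hp, hf⟩ := hfin W inferInstance
  exact selmerCap_conclusion_of_summit_of_shaFiniteAtOnePrime hS W ⟨p, hp, hf⟩

/-! ## §4 Relation to the sibling ∀-form crux `SelmerRankUB` (stmt-0130) -/

/-- `SelmerRankUB` gives C3 on NON-CM curves through the proved Serre prime supply
`exists_goodOrdinary_surjective_of_not_hasCM`. -/
theorem selmerCap_nonCM_of_selmerRankUB (hUB : ShadowIsolation.SelmerRankUB)
    (W : WeierstrassCurve ℚ) [W.IsElliptic] [W.IsGloballyMinimal] (hCM : ¬ W.HasCM) :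
    ∃ (p : ℕ) (_ : Fact p.Prime), W.selmerCorank p ≤ W.analyticRank := by
  obtain ⟨p, hp, h5, hg, ho, hs⟩ := exists_goodOrdinary_surjective_of_not_hasCM W hCM
  exact ⟨p, hp, hUB W p h5 hg ho hs⟩

/-- C3 ⇐ `SelmerRankUB` (0130) ∧ the CM sector of C3 (Rubin-side). -/
theorem selmerCap_of_selmerRankUB_of_cm (hUB : ShadowIsolation.SelmerRankUB)
    (hCMcase : ∀ (W : WeierstrassCurve ℚ) [W.IsElliptic] [W.IsGloballyMinimal], W.HasCM →
      2 ≤ W.analyticRank → ∃ (p : ℕ) (_ : Fact p.Prime), W.selmerCorank p ≤ W.analyticRank) :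
    SelmerCapAtOnePrime := by
  intro W _ _ hr
  by_cases hCM : W.HasCM
  · exact hCMcase W hCM hr
  · exact selmerCap_nonCM_of_selmerRankUB hUB W hCM

/-! ## §5 Mutation and cells -/

/-- `2 ≤ r_an` DROPPED: modulo Gross–Zagier–Kolyvagin (`rank_eq_analyticRank_of_analyticRank_le_one`)
the conclusion holds at every prime when `r_an ≤ 1` — the hypothesis only scopes the open region. -/
theorem selmerCap_conclusion_of_analyticRank_le_one (hGZK : rank_eq_analyticRank_of_analyticRank_le_one)
    (W : WeierstrassCurve ℚ) [W.IsElliptic] (hr : W.analyticRank ≤ 1) :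
    ∃ (p : ℕ) (_ : Fact p.Prime), W.selmerCorank p ≤ W.analyticRank :=
  ⟨2, ⟨Nat.prime_two⟩, (selmerCorank_eq_analyticRank_of_analyticRank_le_one hGZK W 2 hr).le⟩

/-- PARITY GAP: modulo `p`-parity (`selmerCorank_mod_two_eq`, Dokchitser–Dokchitser 2010) a counterexample
curve has `corank_p ≥ r_an + 2 ≥ 4` at EVERY prime. -/
theorem four_le_selmerCorank_everywhere_of_failure (W : WeierstrassCurve ℚ) [W.IsElliptic]
    (hpar : ∀ (p : ℕ) [Fact p.Prime], selmerCorank_mod_two_eq W p) (hr : 2 ≤ W.analyticRank)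
    (hall : ∀ (p : ℕ) [Fact p.Prime], W.analyticRank < W.mordellWeilRank + W.shaCorank p)
    (p : ℕ) [Fact p.Prime] : 4 ≤ W.selmerCorank p := by
  have h1 := hall p
  have h2 : W.selmerCorank p = W.mordellWeilRank + W.shaCorank p :=
    W.selmerCorank_eq_mordellWeilRank_add_holds p
  have h3 := hpar p
  unfold selmerCorank_mod_two_eq at h3
  omega

end Summit.BirchSwinnertonDyer.BirchSwinnertonDyer.Cruxes.SelmerCapAtOnePrime.Attack
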